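import Mathlib
import Literature.Probability.Percolation.SitePaths
import Literature.Probability.Percolation.SiteLoopDensity
import Literature.Probability.Percolation.FullPlaneCNL
import Literature.Probability.Percolation.FullPlaneCNLProofs
import Literature.Probability.Percolation.InterfaceLoopPolygon
import Literature.Probability.LatticeModels.TriangularLatticeProofs
import Summits.CriticalPhenomena.CardyFormulaZ2.Theorems.CardyMagicRigidityHexSegmentDefs
import Summits.CriticalPhenomena.CardyFormulaZ2.Theorems.CardyMagicRigidityLoopLimitZ2EqTSiteEndCoords
import Summits.CriticalPhenomena.CardyFormulaZ2.Theorems.CardyMagicRigidityLoopLimitZ2EqTSiteEndClusters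
import Summits.CriticalPhenomena.CardyFormulaZ2.Theorems.CardyMagicRigidityLoopLimitZ2EqTSiteEndOuterBoundary
import Summits.CriticalPhenomena.CardyFormulaZ2.Theorems.CardyMagicRigidityLoopLimitZ2EqTSiteEndAssembly
import HarnessLib

/-!
# Stub `stub_siteEnd` (S2) of line `Sketch`, crux `LoopLimitZ2EqT` (stmt-CriticalPhenomena-4833):
# the loop dictionary reduced to its metric core (finiteness transfer, dust loops)

Helper file (`--supports stmt-CriticalPhenomena-4833`), continuing the loops ↔ clusters route to
the loop dictionary (4) of `CardyMagicRigidityLoopLimitZ2EqTSiteEndAssembly.lean` for the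
blow-up `β τ = {v | (∀ i, 2 ∣ v i) ∨ ⌊v/2⌋ ∈ τ}`:

* `siteEnd_finite_blowup_cluster`, `siteEnd_finite_cluster_of_finite_blowup` (and the closed
  versions `siteEnd_finite_compl_blowup_cluster`, `siteEnd_finite_compl_cluster_of_finite_blowup`)
  — **the open (closed) cluster of a cell `x` in `τ` is finite iff the open (closed) fine cluster
  of its block centre `2x + (1,1)` in `β τ` is finite** (cluster dictionary of
  `…SiteEndClusters.lean`; a corner in the fine cluster hangs on a non-corner site of it,
  `siteEnd_exists_adj_of_pathIn_blowup_even`). With `…SiteEndOuterBoundary.lean` this matches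
  the type-`1` (type-`0`) loops of `τ` with the type-`1` (type-`0`) loops of `β τ` whose left
  (right) cluster contains a block centre.
* **Dust.** `siteEnd_blowup_mem_isoOpen` — an isolated corner `2z` (`z, z - e₀, z - e₁ ∉ τ`,
  `siteEnd_corner_isolated_iff`) is an isolated open site of `β τ`; `siteEnd_dust_loop` — the
  hexagon `hexAround (2z)` is then a type-`1` interface loop of `β τ` with trace of diameter
  `≤ δ` at mesh `δ/2`; `siteEnd_lv_hexAround`, `siteEnd_diam_le_of_lv_isolated_corner` — every
  type-`1` interface loop of `β τ` whose first left site is an isolated corner IS that hexagon as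
  an unbased loop (`siteEnd_unbasedLoop_eq_of_pathIn`), hence has diameter `≤ δ`: these are the
  dust loops of the dictionary (the remaining type-`1` loops of `β τ` have a non-corner left site,
  whose block centre is joined to it, `siteEnd_pathIn_blowup_ctr`).
* **`siteEnd_loopDictionary_of_metric`, `siteEnd_of_metric`** — **the loop dictionary (4), hence
  `SiteEndLoops`, follows from its metric core**: (M1) a type-`1` loop of `τ` (mesh `δ`) and a
  type-`1` loop of `β τ` (mesh `δ/2`) whose left cluster contains the block centre of the first
  left site of the former are within `d ≤ C δ`; (M0) the same for type-`0` loops and right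
  (closed) clusters. (Everything else — which loop corresponds to which, finiteness, dust — is
  supplied by the files above; (M1)/(M0) is the fellow-travelling of the outer boundary of a
  finite cluster of `δ𝕋` and the outer boundary of its blow-up, the one remaining input of S2.)
-/

noncomputable section

open Set Metric

namespace Summit.CriticalPhenomena.CardyFormulaZ2.Cruxes.LoopLimitZ2EqT.HexSegment

open Literature.Probability.Percolation Literature.Probability.LatticeModels
  Literature.Probability.RandomPlanarGeometry

/-! ### Finiteness transfer between the clusters of `τ` and of its blow-up -/

section Dust

variable {τ : SiteConfig (Site 2)}

/-- A fine path of open sites from a block centre to a corner ends with a step from a non-corner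
open site (two corners are never adjacent). -/
theorem siteEnd_exists_adj_of_pathIn_blowup_even {x v : Site 2}
    (h : PathIn triGraph {v : Site 2 | (∀ i, (2 : ℤ) ∣ v i) ∨ (fun i => v i / 2) ∈ τ}
      (fun i => 2 * x i + 1) v) (hv : ∀ i, (2 : ℤ) ∣ v i) :
    ∃ u : Site 2, PathIn triGraph {v : Site 2 | (∀ i, (2 : ℤ) ∣ v i) ∨ (fun i => v i / 2) ∈ τ}
      (fun i => 2 * x i + 1) u ∧ (¬ ∀ i, (2 : ℤ) ∣ u i) ∧ triGraph.Adj u v := by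
  obtain ⟨hs, h⟩ := h
  rcases (Relation.ReflTransGen.cases_tail_iff _ _ _).1 h with rfl | ⟨u, hu, huv⟩
  · exact absurd hv (siteEnd_ctr_not_even x)
  · have hu' : ¬ ∀ i, (2 : ℤ) ∣ u i := fun hu' => siteEnd_not_adj_of_even hu' hv huv.1
    exact ⟨u, ⟨hs, hu⟩, hu', huv.1⟩

/-- The block of a cell is finite (four fine sites). -/
theorem siteEnd_finite_block (y : Site 2) : {v : Site 2 | (fun i => v i / 2) = y}.Finite := by
  refine (Set.Finite.pi (t := fun i : Fin 2 => Set.Icc (2 * y i) (2 * y i + 1))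
    fun i => Set.finite_Icc _ _).subset fun v hv => ?_
  simp only [Set.mem_pi, Set.mem_univ, Set.mem_Icc, forall_const]
  intro i
  have := congrFun hv i
  omega

/-- **If the open cluster of the cell `x` is finite, so is the open fine cluster of its block
centre in the blow-up**: a non-corner fine site of that cluster halves into the cluster of `x`
(`siteEnd_pathIn_of_pathIn_blowup`), and a corner in it is a neighbour of such a site. -/
theorem siteEnd_finite_blowup_cluster {x : Site 2} (hfin : {y : Site 2 | PathIn triGraph τ x y}.Finite) :
    {v : Site 2 | PathIn triGraph {v : Site 2 | (∀ i, (2 : ℤ) ∣ v i) ∨ (fun i => v i / 2) ∈ τ}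
      (fun i => 2 * x i + 1) v}.Finite := by
  set S : Set (Site 2) := {y : Site 2 | PathIn triGraph τ x y} with hS
  set T : Set (Site 2) := ⋃ y ∈ S, {v : Site 2 | (fun i => v i / 2) = y} with hT
  have hTfin : T.Finite := hfin.biUnion fun y _ => siteEnd_finite_block y
  have hT'fin : (⋃ u ∈ T, (triGraph.neighborSet u)).Finite :=
    hTfin.biUnion fun u _ => (triGraph.neighborFinset u).finite_toSet.subset fun w hw => by
      simpa using hw
  have key : ∀ u : Site 2, PathIn triGraph {v : Site 2 | (∀ i, (2 : ℤ) ∣ v i) ∨ (fun i => v i / 2) ∈ τ}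
      (fun i => 2 * x i + 1) u → (¬ ∀ i, (2 : ℤ) ∣ u i) → u ∈ T := fun u hu hu' => by
    have hp := siteEnd_pathIn_of_pathIn_blowup hu (siteEnd_ctr_not_even x) hu'
    rw [siteEnd_half_ctr] at hp
    exact Set.mem_biUnion (show (fun i => u i / 2) ∈ S from hp) rfl
  refine (hTfin.union hT'fin).subset fun v hv => ?_
  by_cases hv' : ∀ i, (2 : ℤ) ∣ v i
  · obtain ⟨u, hu, hu', huv⟩ := siteEnd_exists_adj_of_pathIn_blowup_even hv hv'
    exact Or.inr (Set.mem_biUnion (key u hu hu') huv)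
  · exact Or.inl (key v hv hv')

/-- **Conversely, if the open fine cluster of the block centre of `x` is finite, so is the open
cluster of `x`** (the centres of the blocks of its cells lie in the fine cluster,
`siteEnd_pathIn_blowup_of_pathIn`, and halve back to the cells). -/
theorem siteEnd_finite_cluster_of_finite_blowup {x : Site 2}
    (hfin : {v : Site 2 | PathIn triGraph {v : Site 2 | (∀ i, (2 : ℤ) ∣ v i) ∨ (fun i => v i / 2) ∈ τ}
      (fun i => 2 * x i + 1) v}.Finite) :
    {y : Site 2 | PathIn triGraph τ x y}.Finite := by
  refine (hfin.image fun v : Site 2 => (fun i => v i / 2 : Site 2)).subset fun y hy => ?_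
  exact ⟨fun i => 2 * y i + 1, siteEnd_pathIn_blowup_of_pathIn hy, siteEnd_half_ctr y⟩

/-- The same two transfers for closed clusters. -/
theorem siteEnd_finite_compl_blowup_cluster {x : Site 2}
    (hfin : {y : Site 2 | PathIn triGraph τᶜ x y}.Finite) :
    {v : Site 2 | PathIn triGraph {v : Site 2 | (∀ i, (2 : ℤ) ∣ v i) ∨ (fun i => v i / 2) ∈ τ}ᶜ
      (fun i => 2 * x i + 1) v}.Finite := by
  refine ((hfin.biUnion fun y _ => siteEnd_finite_block y)).subset fun v hv => ?_
  have hp := siteEnd_pathIn_of_pathIn_compl_blowup hv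
  rw [siteEnd_half_ctr] at hp
  exact Set.mem_biUnion (show (fun i => v i / 2) ∈ {y : Site 2 | PathIn triGraph τᶜ x y} from hp) rfl

/-- Closed clusters: fine finite implies coarse finite. -/
theorem siteEnd_finite_compl_cluster_of_finite_blowup {x : Site 2}
    (hfin : {v : Site 2 | PathIn triGraph {v : Site 2 | (∀ i, (2 : ℤ) ∣ v i) ∨ (fun i => v i / 2) ∈ τ}ᶜ
      (fun i => 2 * x i + 1) v}.Finite) :
    {y : Site 2 | PathIn triGraph τᶜ x y}.Finite := by
  refine (hfin.image fun v : Site 2 => (fun i => v i / 2 : Site 2)).subset fun y hy => ?_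
  exact ⟨fun i => 2 * y i + 1, siteEnd_pathIn_compl_blowup_of_pathIn hy, siteEnd_half_ctr y⟩

/-! ### Dust: the hexagon around an isolated corner -/

/-- `hexDir 0 = e₁`. -/
theorem siteEnd_hexDir_zero : hexDir 0 = Pi.single 1 1 := rfl

/-- **An isolated corner of the blow-up is an isolated open site**: if `z, z - e₀, z - e₁ ∉ τ`
then the blow-up lies in `isoOpen (2z)`. -/
theorem siteEnd_blowup_mem_isoOpen {z : Site 2} (hz : z ∉ τ) (hz₀ : z - Pi.single 0 1 ∉ τ)
    (hz₁ : z - Pi.single 1 1 ∉ τ) :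
    ({v : Site 2 | (∀ i, (2 : ℤ) ∣ v i) ∨ (fun i => v i / 2) ∈ τ} : SiteConfig (Site 2)) ∈
      isoOpen (fun i => 2 * z i) := by
  refine ⟨Or.inl fun i => ⟨z i, rfl⟩, fun k => ?_⟩
  exact (siteEnd_corner_isolated_iff τ z).2 ⟨hz, hz₀, hz₁⟩ _ (triGraph_adj_add_hexDir _ k)

/-- **The dust loop.** Around an isolated corner `2z` the hexagon `hexAround (2z)` is a type-`1`
interface loop of the blow-up whose unbased loop at mesh `δ/2 ≥ 0` has trace in the closed ball
of radius `δ/2` about the coarse point `δ z`, hence diameter `≤ δ`. -/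
theorem siteEnd_dust_loop : ∀ {τ : SiteConfig (Site 2)} {z : Site 2}, z ∉ τ → z - Pi.single 0 1 ∉ τ →
    z - Pi.single 1 1 ∉ τ → ∀ {δ : ℝ}, 0 ≤ δ →
    IsSiteInterfaceLoop {v : Site 2 | (∀ i, (2 : ℤ) ∣ v i) ∨ (fun i => v i / 2) ∈ τ}
        (hexAround (fun i => 2 * z i)) ∧
      0 < shoelace ((hexAround (fun i => 2 * z i)).support.map hexCenter) ∧
      Metric.diam (UnbasedLoop.mk (BasedLoop.mk (siteLoopCurve (δ / 2) (hexAround (fun i => 2 * z i)))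
        (isLoop_siteLoopCurve (δ / 2) _))).range ≤ δ := by
  intro τ z hz hz₀ hz₁ δ hδ
  refine ⟨isSiteInterfaceLoop_hexAround (siteEnd_blowup_mem_isoOpen hz hz₀ hz₁),
    shoelace_hexAround_pos _, ?_⟩
  rw [range_mk_siteLoopCurve]
  have hsub := range_toCurve_hexAround_subset (δ := δ / 2) (by linarith) (fun i => 2 * z i : Site 2)
  calc Metric.diam (Set.range ((hexAround (fun i => 2 * z i : Site 2)).toCurve fun v => ((δ / 2 : ℝ) : ℂ) * hexCenter v))
      ≤ Metric.diam (closedBall (triMeshPoint (δ / 2) (fun i => 2 * z i : Site 2)) (δ / 2)) :=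
        Metric.diam_mono hsub isBounded_closedBall
    _ ≤ 2 * (δ / 2) := Metric.diam_closedBall (by linarith)
    _ = δ := by ring

/-- **The left site of the hexagon loop around an isolated open site is that site.** -/
theorem siteEnd_lv_hexAround {ω : SiteConfig (Site 2)} {x : Site 2} (h : ω ∈ isoOpen x) :
    (isSiteInterfaceLoop_hexAround h).lv 0 = x := by
  have hw := isSiteInterfaceLoop_hexAround h
  have hlen : 0 < (hexAround x).length := by have := hw.isCycle.three_le_length; omega
  have hmem := hw.lv_mem_hexFaceVertices hlen
  have hF : hexFaceVertices ((hexAround x).getVert 0) = hexFaceVertices (x, 0) := by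
    rw [SimpleGraph.Walk.getVert_zero, hexFace_zero]
  rw [hF, mem_hexFaceVertices_zero] at hmem
  have hopen := hw.lv_mem hlen
  rcases hmem with hm | hm | hm
  · exact hm
  · exact absurd (hm ▸ hopen) (h.2 5)
  · exact absurd (hm ▸ hopen) (h.2 0)

/-- **Every type-`1` interface loop of the blow-up whose first left site is an isolated corner is
the dust hexagon**, as an unbased loop (`siteEnd_unbasedLoop_eq_of_pathIn`); in particular its
trace at mesh `δ/2` has diameter `≤ δ`. -/
theorem siteEnd_diam_le_of_lv_isolated_corner {f₀ : HexVertex} {w : hexGraph.Walk f₀ f₀}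
    (hw : IsSiteInterfaceLoop {v : Site 2 | (∀ i, (2 : ℤ) ∣ v i) ∨ (fun i => v i / 2) ∈ τ} w)
    (hpos : 0 < shoelace (w.support.map hexCenter)) {z : Site 2} (hlv : hw.lv 0 = fun i => 2 * z i)
    (hz : z ∉ τ) (hz₀ : z - Pi.single 0 1 ∉ τ) (hz₁ : z - Pi.single 1 1 ∉ τ) {δ : ℝ} (hδ : 0 ≤ δ) :
    Metric.diam (UnbasedLoop.mk (BasedLoop.mk (siteLoopCurve (δ / 2) w)
      (isLoop_siteLoopCurve (δ / 2) w))).range ≤ δ := by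
  obtain ⟨hhex, hhexpos, hdiam⟩ := siteEnd_dust_loop hz hz₀ hz₁ hδ
  have hiso := siteEnd_blowup_mem_isoOpen hz hz₀ hz₁
  have hl : (isSiteInterfaceLoop_hexAround hiso).lv 0 = fun i => 2 * z i := siteEnd_lv_hexAround hiso
  have heq := siteEnd_unbasedLoop_eq_of_pathIn hw (isSiteInterfaceLoop_hexAround hiso) hpos hhexpos
    (by rw [hlv, hl]; exact PathIn.refl hiso.1) (δ / 2)
  rw [heq]
  exact hdiam

end Dust

/-! ### The loop dictionary from the metric fellow-travelling of corresponding outer boundaries -/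

/-- **Reduction of the loop dictionary (4) to its metric core.** Suppose that, uniformly in the
mesh `δ > 0` and the cell set `τ`, (M1) a type-`1` interface loop `Γ` of `τ` and a type-`1`
interface loop `γ` of the blow-up `β τ` whose left cluster contains the block centre of the first
left site of `Γ` are within `d ≤ C δ` (as unbased loops at meshes `δ` and `δ/2`), and (M0) the
same for type-`0` loops and right (closed) clusters. Then the loop dictionary holds: a coarse
loop is matched with the outer boundary of the corresponding finite fine cluster
(`siteEnd_exists_loop_of_finite`, finiteness by `siteEnd_finite_cluster_of_shoelace_pos` and
`siteEnd_finite_blowup_cluster`), and a fine loop either hangs on a non-corner site — then it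
is matched with the outer boundary of the corresponding finite coarse cluster — or its left
cluster is an isolated corner and it is dust of diameter `≤ δ`
(`siteEnd_diam_le_of_lv_isolated_corner`). -/
theorem siteEnd_loopDictionary_of_metric :
    (∃ C : ℝ, ∀ δ : ℝ, 0 < δ → ∀ (τ : SiteConfig (Site 2)) {F : HexVertex} {Γ : hexGraph.Walk F F}
      (hΓ : IsSiteInterfaceLoop τ Γ) {f : HexVertex} {γ : hexGraph.Walk f f}
      (hγ : IsSiteInterfaceLoop {v : Site 2 | (∀ j, (2 : ℤ) ∣ v j) ∨ (fun j => v j / 2) ∈ τ} γ),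
      0 < shoelace (Γ.support.map hexCenter) → 0 < shoelace (γ.support.map hexCenter) →
      PathIn triGraph {v : Site 2 | (∀ j, (2 : ℤ) ∣ v j) ∨ (fun j => v j / 2) ∈ τ}
        (fun j => 2 * hΓ.lv 0 j + 1) (hγ.lv 0) →
      (UnbasedLoop.mk (BasedLoop.mk (siteLoopCurve δ Γ) (isLoop_siteLoopCurve δ Γ))).udist
        (UnbasedLoop.mk (BasedLoop.mk (siteLoopCurve (δ / 2) γ) (isLoop_siteLoopCurve (δ / 2) γ))) ≤
        C * δ) →
    (∃ C : ℝ, ∀ δ : ℝ, 0 < δ → ∀ (τ : SiteConfig (Site 2)) {F : HexVertex} {Γ : hexGraph.Walk F F}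
      (hΓ : IsSiteInterfaceLoop τ Γ) {f : HexVertex} {γ : hexGraph.Walk f f}
      (hγ : IsSiteInterfaceLoop {v : Site 2 | (∀ j, (2 : ℤ) ∣ v j) ∨ (fun j => v j / 2) ∈ τ} γ),
      shoelace (Γ.support.map hexCenter) ≤ 0 → shoelace (γ.support.map hexCenter) ≤ 0 →
      PathIn triGraph {v : Site 2 | (∀ j, (2 : ℤ) ∣ v j) ∨ (fun j => v j / 2) ∈ τ}ᶜ
        (fun j => 2 * hΓ.rv 0 j + 1) (hγ.rv 0) →
      (UnbasedLoop.mk (BasedLoop.mk (siteLoopCurve δ Γ) (isLoop_siteLoopCurve δ Γ))).udist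
        (UnbasedLoop.mk (BasedLoop.mk (siteLoopCurve (δ / 2) γ) (isLoop_siteLoopCurve (δ / 2) γ))) ≤
        C * δ) →
    ∃ C : ℝ, ∀ δ : ℝ, 0 < δ → ∀ (τ : SiteConfig (Site 2)) (i : Fin 2),
      (∀ u ∈ (siteLoopConfig δ τ).F i, ∃ u' ∈ (siteLoopConfig (δ / 2)
          {v : Site 2 | (∀ j, (2 : ℤ) ∣ v j) ∨ (fun j => v j / 2) ∈ τ}).F i, u.udist u' ≤ C * δ) ∧
      (∀ u' ∈ (siteLoopConfig (δ / 2)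
          {v : Site 2 | (∀ j, (2 : ℤ) ∣ v j) ∨ (fun j => v j / 2) ∈ τ}).F i,
        (∃ u ∈ (siteLoopConfig δ τ).F i, u'.udist u ≤ C * δ) ∨ Metric.diam u'.range ≤ C * δ) := by
  rintro ⟨C₁, hC₁⟩ ⟨C₀, hC₀⟩
  set C : ℝ := max (max C₁ C₀) 1 with hC
  refine ⟨C, fun δ hδ τ i => ?_⟩
  have hm₁ : C₁ * δ ≤ C * δ :=
    mul_le_mul_of_nonneg_right ((le_max_left _ _).trans (le_max_left _ _)) hδ.le
  have hm₀ : C₀ * δ ≤ C * δ :=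
    mul_le_mul_of_nonneg_right ((le_max_right _ _).trans (le_max_left _ _)) hδ.le
  have hmδ : δ ≤ C * δ := le_mul_of_one_le_left hδ.le (le_max_right _ _)
  refine ⟨fun u hu => ?_, fun u' hu' => ?_⟩
  · -- coarse loops have fine partners
    obtain ⟨v, Γ, hΓ, htype, rfl⟩ := mem_siteLoopConfig_iff.1 hu
    have hlen : 0 < Γ.length := by have := hΓ.isCycle.three_le_length; omega
    by_cases hi : i = 1
    · have hpos : 0 < shoelace (Γ.support.map hexCenter) := htype.1 hi
      have hx : hΓ.lv 0 ∈ τ := hΓ.lv_mem hlen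
      have hfin' := siteEnd_finite_blowup_cluster (siteEnd_finite_cluster_of_shoelace_pos hΓ hpos)
      obtain ⟨f, γ, hγ, hγpos, hγlv⟩ :=
        siteEnd_exists_loop_of_finite ((siteEnd_ctr_mem_blowup_iff τ (hΓ.lv 0)).2 hx) hfin'
      have hγlen : 0 < γ.length := by have := hγ.isCycle.three_le_length; omega
      exact ⟨_, mem_siteLoopConfig_iff.2 ⟨f, γ, hγ, ⟨fun _ => hγpos, fun _ => hi⟩, rfl⟩,
        (hC₁ δ hδ τ hΓ hγ hpos hγpos (hγlv 0 hγlen)).trans hm₁⟩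
    · have hle : shoelace (Γ.support.map hexCenter) ≤ 0 := not_lt.1 fun h => hi (htype.2 h)
      have hy : hΓ.rv 0 ∉ τ := hΓ.rv_not_mem hlen
      have hfin' := siteEnd_finite_compl_blowup_cluster
        (siteEnd_finite_cluster_of_shoelace_nonpos hΓ hle)
      obtain ⟨f, γ, hγ, hγle, hγrv⟩ := siteEnd_exists_loop_of_finite_compl
        (ω := {v : Site 2 | (∀ j, (2 : ℤ) ∣ v j) ∨ (fun j => v j / 2) ∈ τ})
        (by rw [siteEnd_ctr_mem_blowup_iff]; exact hy) hfin'
      have hγlen : 0 < γ.length := by have := hγ.isCycle.three_le_length; omega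
      exact ⟨_, mem_siteLoopConfig_iff.2 ⟨f, γ, hγ,
        ⟨fun h => absurd h hi, fun h => absurd h (not_lt.2 hγle)⟩, rfl⟩,
        (hC₀ δ hδ τ hΓ hγ hle hγle (hγrv 0 hγlen)).trans hm₀⟩
  · -- fine loops have coarse partners, or are dust
    obtain ⟨f, γ, hγ, htype, rfl⟩ := mem_siteLoopConfig_iff.1 hu'
    have hγlen : 0 < γ.length := by have := hγ.isCycle.three_le_length; omega
    by_cases hi : i = 1
    · have hpos : 0 < shoelace (γ.support.map hexCenter) := htype.1 hi
      have hv₀ := hγ.lv_mem hγlen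
      -- either the left cluster contains a non-corner site, or it is an isolated corner
      have key : (∃ w : Site 2, PathIn triGraph {v : Site 2 | (∀ j, (2 : ℤ) ∣ v j) ∨ (fun j => v j / 2) ∈ τ}
          (hγ.lv 0) w ∧ ¬ ∀ j, (2 : ℤ) ∣ w j) ∨
          (∃ z : Site 2, hγ.lv 0 = (fun j => 2 * z j) ∧ z ∉ τ ∧ z - Pi.single 0 1 ∉ τ ∧
            z - Pi.single 1 1 ∉ τ) := by
        by_cases hc : ∀ j, (2 : ℤ) ∣ hγ.lv 0 j
        · set z : Site 2 := fun j => hγ.lv 0 j / 2 with hz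
          have hv : hγ.lv 0 = fun j => 2 * z j := funext fun j => by
            obtain ⟨c, hc'⟩ := hc j
            simp only [hz]
            omega
          by_cases hisol : z ∉ τ ∧ z - Pi.single 0 1 ∉ τ ∧ z - Pi.single 1 1 ∉ τ
          · exact Or.inr ⟨z, hv, hisol⟩
          · have h' := mt (siteEnd_corner_isolated_iff τ z).1 hisol
            push Not at h'
            obtain ⟨w, hadj, hw⟩ := h'
            have hzeven : ∀ j, (2 : ℤ) ∣ (fun j => 2 * z j : Site 2) j := fun j => ⟨z j, rfl⟩
            have hwnc : ¬ ∀ j, (2 : ℤ) ∣ w j := fun h => siteEnd_not_adj_of_even hzeven h hadj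
            refine Or.inl ⟨w, ?_, hwnc⟩
            rw [hv]
            exact PathIn.of_adj (hv ▸ hv₀) hw hadj
        · exact Or.inl ⟨hγ.lv 0, PathIn.refl hv₀, hc⟩
      rcases key with ⟨w, hvw, hwnc⟩ | ⟨z, hv, hz, hz₀, hz₁⟩
      · left
        have hwβ := hvw.right_mem
        have hxτ : (fun j => w j / 2) ∈ τ := hwβ.resolve_left hwnc
        have hwc := siteEnd_pathIn_blowup_ctr hwβ hwnc
        have hfin' : {v : Site 2 | PathIn triGraph {v : Site 2 | (∀ j, (2 : ℤ) ∣ v j) ∨ (fun j => v j / 2) ∈ τ}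
            (fun j => 2 * (w j / 2) + 1) v}.Finite :=
          (siteEnd_finite_cluster_of_shoelace_pos hγ hpos).subset fun v hv =>
            (hvw.trans hwc).trans hv
        obtain ⟨F, Γ, hΓ, hΓpos, hΓlv⟩ :=
          siteEnd_exists_loop_of_finite hxτ (siteEnd_finite_cluster_of_finite_blowup hfin')
        have hΓlen : 0 < Γ.length := by have := hΓ.isCycle.three_le_length; omega
        refine ⟨_, mem_siteLoopConfig_iff.2 ⟨F, Γ, hΓ, ⟨fun _ => hΓpos, fun _ => hi⟩, rfl⟩, ?_⟩
        have hp := (siteEnd_pathIn_blowup_of_pathIn (hΓlv 0 hΓlen).symm).trans (hwc.symm.trans hvw.symm)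
        rw [UnbasedLoop.udist_comm]
        exact (hC₁ δ hδ τ hΓ hγ hΓpos hpos hp).trans hm₁
      · right
        exact (siteEnd_diam_le_of_lv_isolated_corner hγ hpos hv hz hz₀ hz₁ hδ.le).trans hmδ
    · have hle : shoelace (γ.support.map hexCenter) ≤ 0 := not_lt.1 fun h => hi (htype.2 h)
      have hr₀ := hγ.rv_not_mem hγlen
      obtain ⟨-, hyτ⟩ := (siteEnd_not_mem_blowup_iff τ (hγ.rv 0)).1 hr₀
      have hrc := siteEnd_pathIn_compl_blowup_ctr hr₀
      have hfin' : {v : Site 2 | PathIn triGraph {v : Site 2 | (∀ j, (2 : ℤ) ∣ v j) ∨ (fun j => v j / 2) ∈ τ}ᶜ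
          (fun j => 2 * (hγ.rv 0 j / 2) + 1) v}.Finite :=
        (siteEnd_finite_cluster_of_shoelace_nonpos hγ hle).subset fun v hv => hrc.trans hv
      obtain ⟨F, Γ, hΓ, hΓle, hΓrv⟩ := siteEnd_exists_loop_of_finite_compl hyτ
        (siteEnd_finite_compl_cluster_of_finite_blowup hfin')
      have hΓlen : 0 < Γ.length := by have := hΓ.isCycle.three_le_length; omega
      left
      refine ⟨_, mem_siteLoopConfig_iff.2 ⟨F, Γ, hΓ,
        ⟨fun h => absurd h hi, fun h => absurd h (not_lt.2 hΓle)⟩, rfl⟩, ?_⟩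
      have hp := (siteEnd_pathIn_compl_blowup_of_pathIn (hΓrv 0 hΓlen).symm).trans hrc.symm
      rw [UnbasedLoop.udist_comm]
      exact (hC₀ δ hδ τ hΓ hγ hΓle hle hp).trans hm₀


/-- **S2 from the metric core.** `SiteEndLoops` follows from (M1) and (M0)
(`siteEnd_loopDictionary_of_metric`, `siteEnd_of_loopDictionary`). -/
theorem siteEnd_of_metric :
    (∃ C : ℝ, ∀ δ : ℝ, 0 < δ → ∀ (τ : SiteConfig (Site 2)) {F : HexVertex} {Γ : hexGraph.Walk F F}
      (hΓ : IsSiteInterfaceLoop τ Γ) {f : HexVertex} {γ : hexGraph.Walk f f}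
      (hγ : IsSiteInterfaceLoop {v : Site 2 | (∀ j, (2 : ℤ) ∣ v j) ∨ (fun j => v j / 2) ∈ τ} γ),
      0 < shoelace (Γ.support.map hexCenter) → 0 < shoelace (γ.support.map hexCenter) →
      PathIn triGraph {v : Site 2 | (∀ j, (2 : ℤ) ∣ v j) ∨ (fun j => v j / 2) ∈ τ}
        (fun j => 2 * hΓ.lv 0 j + 1) (hγ.lv 0) →
      (UnbasedLoop.mk (BasedLoop.mk (siteLoopCurve δ Γ) (isLoop_siteLoopCurve δ Γ))).udist
        (UnbasedLoop.mk (BasedLoop.mk (siteLoopCurve (δ / 2) γ) (isLoop_siteLoopCurve (δ / 2) γ))) ≤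
        C * δ) →
    (∃ C : ℝ, ∀ δ : ℝ, 0 < δ → ∀ (τ : SiteConfig (Site 2)) {F : HexVertex} {Γ : hexGraph.Walk F F}
      (hΓ : IsSiteInterfaceLoop τ Γ) {f : HexVertex} {γ : hexGraph.Walk f f}
      (hγ : IsSiteInterfaceLoop {v : Site 2 | (∀ j, (2 : ℤ) ∣ v j) ∨ (fun j => v j / 2) ∈ τ} γ),
      shoelace (Γ.support.map hexCenter) ≤ 0 → shoelace (γ.support.map hexCenter) ≤ 0 →
      PathIn triGraph {v : Site 2 | (∀ j, (2 : ℤ) ∣ v j) ∨ (fun j => v j / 2) ∈ τ}ᶜ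
        (fun j => 2 * hΓ.rv 0 j + 1) (hγ.rv 0) →
      (UnbasedLoop.mk (BasedLoop.mk (siteLoopCurve δ Γ) (isLoop_siteLoopCurve δ Γ))).udist
        (UnbasedLoop.mk (BasedLoop.mk (siteLoopCurve (δ / 2) γ) (isLoop_siteLoopCurve (δ / 2) γ))) ≤
        C * δ) →
    SiteEndLoops :=
  fun h1 h0 => siteEnd_of_loopDictionary (siteEnd_loopDictionary_of_metric h1 h0)

end Summit.CriticalPhenomena.CardyFormulaZ2.Cruxes.LoopLimitZ2EqT.HexSegment

end
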